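/-
Copyright: pub-balaban β-flow team, β-FLOW PROVER 4 (unit `b2b-balaban-beta-bflow-p4`, gen 16; coordinator ruling «YM
ACCELERATION» 2026-08-21 item (2), «work behind the as-printed interface»).  NON-VACUITY OF THE REFLECTION BLOCK OF PARTs 29d ∕ 29e: on
the reflection orbit of a cube (PART 29h), the ULTRALOCAL kernels b·[q = q′] on the plaquettes inside each cube, the Hessians they define
on curls and PART 29f's potentials satisfy the remaining binders of `totals_signCovariant_of_hessianReflection` — transport of the Hessians
`hHρ`, potentials `hpot` ∕ `hApot`, support ∕ kernel bookkeeping `hSpP` ∕ `hKS` ∕ `hρρ` (the factorization `hfac` holds by construction) —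
with a NON-ZERO matrix of totals.  So the sign conventions of the block (field action, plaquette pull-back, potentials) are jointly
consistent and the block is not vacuous.  Lattice bookkeeping; nothing of Bałaban's asserted; NOT N5 for the model, NOT BetaPertH, NOT
continuum, NOT Clay.
-/
import Mathlib
import Summits.QuantumFields.BalabanUV.Beta.EriceCurvatureFormTorusPullback
import Summits.QuantumFields.BalabanUV.Beta.EriceCurvatureFormTorusPotential

/-!
# `Beta.EriceCurvatureFormHessianCovarianceWitness` — PART 29i of the `EriceLoopExpansionD4` series: the reflection orbit of a cube with
# ultralocal kernels inhabits the reflection block of PARTs 29d ∕ 29e with a non-zero total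

Source: T. Bałaban, A. Jaffe, *Constructive gauge theory* (Erice 1985) [BalabanJaffe1986], Part III (3.38)–(3.40) p. 245, (3.65) p. 249;
T. Bałaban, Commun. Math. Phys. **109** (1987) [Balaban1987RG1] (5.2)–(5.3) p. 292, (5.7) p. 293; this lineage's PART 29d
`EriceCurvatureFormHessianCovarianceTorus.totals_signCovariant_of_hessianReflection` (the block witnessed), PART 29h
`EriceCurvatureFormTorusPullback` (the family: corners `hy`, cubes `hP`, supports `hSp`, reflections `hρ`; `pullback_mem_support` = the block's
`hSρ`; `pullback_pullback`, `cube_subset_box`), PART 29b `EriceCurvatureFormTorusCurl.curl_reflect_emod`, PART 29f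
`EriceCurvatureFormTorusPotential` (`hpot_of_cube`, `potential_periodic`), PART 28f `EriceCurvatureFormTorusWitness` (companion).

THE KERNELS (letters): K_s(q,q′) = b·[q = q′ ∈ Sp_s] (`hK`); the curl letter (`hcu`); Hs_s(A,A′) := the factorized four-fold sum (`hHs`);
potentials A^s_{(a,b)}(x)_c = [c = b]·((x_a − y(s)_a) mod N) (`hA`).

WHAT IS KERNEL-CHECKED HERE (def-free; [folklore]):
* §3 `hess_eq_sum_support` (Hs_s(A,A′) = b·Σ_{q∈Sp_s} cu A q·cu A′ q), **`hess_transport`** — the block's `hHρ`: Hs_{ρ_α s}(εA, εA′) = Hs_s(A, A′)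
  for periodic A, A′ (plaquette law of the reflected curl, ε² = 1, re-indexing by the involutive pull-back).
* §4 **`potentials_on_cubes`** (the block's `hpot`), **`block_bookkeeping`** (`hSpP`, `hKS`, `hρρ`, `hApot`), `total_diag_eq`,
  `corner_plaquette_mem`, **`total_diag_ne_zero`** (b ≠ 0, m ≥ 1 ⟹ the total at every label is non-zero).
HONEST: a toy family (Maxwell-type kernels on an orbit of cubes), no claim about Bałaban's kernels; NOT N5 for the model, NOT (3.36), NOT B12
Thm 2, NOT BetaPertH, NOT continuum, NOT Clay.  HONEST DEPENDENCY: continuum YM on T⁴ ⇐ BetaPertH ∧ nine spine estimates (0/9 proved);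
BetaPertH ⇐ (D1) ∧ (D4) ∧ CAP+tail; G-an2-4 gates asym, D1 and NE2/3/4.
-/

namespace Summit.QuantumFields.BalabanUV.Beta.EriceCurvatureFormHessianCovarianceWitness

open scoped BigOperators
open Finset
open Literature.MathematicalPhysics.QuantumFieldTheory.Balaban1983to89
open Literature.MathematicalPhysics.QuantumFieldTheory.Balaban1983to89.B7Prop1Explicit (e e_apply)
open Literature.MathematicalPhysics.QuantumFieldTheory.Balaban1983to89.Beta.PolarizationSign
  (axisReflect axisReflect_apply reflSign)
open Summit.QuantumFields.BalabanUV.Beta.EriceCurvatureFormReflection (reflSign_mul_self)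
open Summit.QuantumFields.BalabanUV.Beta.EriceCurvatureFormTorusCurl (curl_reflect_emod)
open Summit.QuantumFields.BalabanUV.Beta.EriceCurvatureFormTorusPotential (potential_periodic hpot_of_cube)
open Summit.QuantumFields.BalabanUV.Beta.EriceCurvatureFormTorusPullback
  (emod_eq_self_of_mem_range mem_cube_iff pullback_pullback cube_subset_box pullback_mem_support)

variable {d : ℕ}

/-! ## §3. The Hessians of the ultralocal kernels and their transport (the block's `hHρ`) -/

section Hessian

variable {N m : ℤ} {𝒳 : Type*}

/-- **The factorized Hessian of the ultralocal kernel** K(q,q′) = b·[q = q′ ∈ Sp] (support Sp with base points in P) is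
b·Σ_{q∈Sp} cu A q·cu A′ q. [folklore] -/
theorem hess_eq_sum_support (P : 𝒳 → Finset (Fin d → ℤ))
    (Sp : 𝒳 → Finset ((Fin d → ℤ) × {o : Fin d × Fin d // o.1 < o.2})) (hSpP : ∀ Y, ∀ q ∈ Sp Y, q.1 ∈ P Y) (b : ℝ)
    (K : 𝒳 → (Fin d → ℤ) × {o : Fin d × Fin d // o.1 < o.2} → (Fin d → ℤ) × {o : Fin d × Fin d // o.1 < o.2} → ℝ)
    (hK : ∀ Y q q', K Y q q' = if (q = q' ∧ q ∈ Sp Y) then b else 0)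
    (cu : ((Fin d → ℤ) → Fin d → ℝ) → (Fin d → ℤ) → Fin d × Fin d → ℝ)
    (Hs : 𝒳 → ((Fin d → ℤ) → Fin d → ℝ) → ((Fin d → ℤ) → Fin d → ℝ) → ℝ)
    (hHs : ∀ Y A A', Hs Y A A' = ∑ x ∈ P Y, ∑ o : {o : Fin d × Fin d // o.1 < o.2}, ∑ x' ∈ P Y,
      ∑ o' : {o : Fin d × Fin d // o.1 < o.2}, K Y (x, o) (x', o') * cu A x o.1 * cu A' x' o'.1)
    (Y : 𝒳) (A A' : (Fin d → ℤ) → Fin d → ℝ) :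
    Hs Y A A' = b * ∑ q ∈ Sp Y, cu A q.1 q.2.1 * cu A' q.1 q.2.1 := by
  classical
  rw [hHs]
  -- as a double sum over P × labels
  have h1 : ∑ x ∈ P Y, ∑ o : {o : Fin d × Fin d // o.1 < o.2}, ∑ x' ∈ P Y, ∑ o' : {o : Fin d × Fin d // o.1 < o.2},
      K Y (x, o) (x', o') * cu A x o.1 * cu A' x' o'.1
      = ∑ q ∈ P Y ×ˢ (Finset.univ : Finset {o : Fin d × Fin d // o.1 < o.2}),
          ∑ q' ∈ P Y ×ˢ (Finset.univ : Finset {o : Fin d × Fin d // o.1 < o.2}),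
            K Y q q' * cu A q.1 q.2.1 * cu A' q'.1 q'.2.1 := by
    rw [Finset.sum_product]
    refine Finset.sum_congr rfl fun x _ => Finset.sum_congr rfl fun o _ => ?_
    rw [Finset.sum_product]
  rw [h1]
  -- the inner sum collapses on the diagonal
  have h2 : ∀ q ∈ P Y ×ˢ (Finset.univ : Finset {o : Fin d × Fin d // o.1 < o.2}),
      ∑ q' ∈ P Y ×ˢ (Finset.univ : Finset {o : Fin d × Fin d // o.1 < o.2}), K Y q q' * cu A q.1 q.2.1 * cu A' q'.1 q'.2.1
        = if q ∈ Sp Y then b * (cu A q.1 q.2.1 * cu A' q.1 q.2.1) else 0 := by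
    intro q hq
    rw [Finset.sum_eq_single_of_mem q hq (fun q' _ hne => by rw [hK, if_neg (fun h => hne h.1.symm), zero_mul, zero_mul])]
    rw [hK]
    by_cases hqS : q ∈ Sp Y
    · rw [if_pos ⟨rfl, hqS⟩, if_pos hqS]; ring
    · rw [if_neg (fun h => hqS h.2), if_neg hqS, zero_mul, zero_mul]
  rw [Finset.sum_congr rfl h2, ← Finset.sum_filter, Finset.mul_sum]
  refine Finset.sum_congr ?_ fun q _ => rfl
  ext q
  simp only [Finset.mem_filter, Finset.mem_product, Finset.mem_univ, and_true]
  exact ⟨fun h => h.2, fun h => ⟨hSpP Y q h, h⟩⟩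

/-- **THE BLOCK's `hHρ` FOR THE ORBIT OF CUBES: transport of the Hessians.**  For the family of §2 with the ultralocal kernels of
`hess_eq_sum_support` and N-periodic A, A′: Hs_{ρ_α s}(εA, εA′) = Hs_s(A, A′) — the plaquette law of the reflected curl (PART 29b
`curl_reflect_emod`, ε² = 1) and the re-indexing of Sp_{ρs} by the involutive pull-back onto Sp_s. [folklore] -/
theorem hess_transport (hN : 0 < N) (hmN : m + 2 ≤ N) (y : (Fin d → Bool) → Fin d → ℤ)
    (hy : ∀ s i, y s i = if s i then N - 1 - m else 1) (P : (Fin d → Bool) → Finset (Fin d → ℤ))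
    (hP : ∀ s, P s = Fintype.piFinset (fun i => Finset.Icc (y s i) (y s i + m)))
    (Sp : (Fin d → Bool) → Finset ((Fin d → ℤ) × {o : Fin d × Fin d // o.1 < o.2}))
    (hSp : ∀ s q, q ∈ Sp s ↔ (q.1 ∈ P s ∧ q.1 + e q.2.1.1 + e q.2.1.2 ∈ P s))
    (ρ : Fin d → (Fin d → Bool) → (Fin d → Bool)) (hρ : ∀ α s, ρ α s = Function.update s α (!(s α))) (b : ℝ)
    (K : (Fin d → Bool) → (Fin d → ℤ) × {o : Fin d × Fin d // o.1 < o.2} → (Fin d → ℤ) × {o : Fin d × Fin d // o.1 < o.2} → ℝ)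
    (hK : ∀ s q q', K s q q' = if (q = q' ∧ q ∈ Sp s) then b else 0)
    (cu : ((Fin d → ℤ) → Fin d → ℝ) → (Fin d → ℤ) → Fin d × Fin d → ℝ)
    (hcu : ∀ A x o, cu A x o = A x o.1 + A (x + e o.1) o.2 - A (x + e o.2) o.1 - A x o.2)
    (Hs : (Fin d → Bool) → ((Fin d → ℤ) → Fin d → ℝ) → ((Fin d → ℤ) → Fin d → ℝ) → ℝ)
    (hHs : ∀ s A A', Hs s A A' = ∑ x ∈ P s, ∑ o : {o : Fin d × Fin d // o.1 < o.2}, ∑ x' ∈ P s,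
      ∑ o' : {o : Fin d × Fin d // o.1 < o.2}, K s (x, o) (x', o') * cu A x o.1 * cu A' x' o'.1)
    (α : Fin d) (s : Fin d → Bool) (A A' : (Fin d → ℤ) → Fin d → ℝ) (hA : ∀ x v ν, A (x + N • v) ν = A x ν)
    (hA' : ∀ x v ν, A' (x + N • v) ν = A' x ν) :
    Hs (ρ α s) (fun x ν => reflSign α ν * A (axisReflect α x - if ν = α then e α else 0) ν)
        (fun x ν => reflSign α ν * A' (axisReflect α x - if ν = α then e α else 0) ν) = Hs s A A' := by
  have hSpP : ∀ s, ∀ q ∈ Sp s, q.1 ∈ P s := fun s q hq => ((hSp s q).1 hq).1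
  rw [hess_eq_sum_support P Sp hSpP b K hK cu Hs hHs, hess_eq_sum_support P Sp hSpP b K hK cu Hs hHs]
  congr 1
  -- the plaquette law of the reflected curls, sign squared away
  have hlaw : ∀ q : (Fin d → ℤ) × {o : Fin d × Fin d // o.1 < o.2},
      cu (fun x ν => reflSign α ν * A (axisReflect α x - if ν = α then e α else 0) ν) q.1 q.2.1
        * cu (fun x ν => reflSign α ν * A' (axisReflect α x - if ν = α then e α else 0) ν) q.1 q.2.1
      = cu A (fun i => (axisReflect α q.1 - if (α = q.2.1.1 ∨ α = q.2.1.2) then e α else 0) i % N) q.2.1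
        * cu A' (fun i => (axisReflect α q.1 - if (α = q.2.1.1 ∨ α = q.2.1.2) then e α else 0) i % N) q.2.1 := by
    intro q
    rw [curl_reflect_emod α A _ (fun _ _ => rfl) hA (fun x p => cu A x p) (fun x p => cu _ x p) (fun x p => hcu A x p)
        (fun x p => hcu _ x p) q.1 q.2.1,
      curl_reflect_emod α A' _ (fun _ _ => rfl) hA' (fun x p => cu A' x p) (fun x p => cu _ x p) (fun x p => hcu A' x p)
        (fun x p => hcu _ x p) q.1 q.2.1]
    have hs := reflSign_mul_self α q.2.1.1
    have hs' := reflSign_mul_self α q.2.1.2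
    calc reflSign α q.2.1.1 * reflSign α q.2.1.2
            * cu A (fun i => (axisReflect α q.1 - if (α = q.2.1.1 ∨ α = q.2.1.2) then e α else 0) i % N) q.2.1
          * (reflSign α q.2.1.1 * reflSign α q.2.1.2
            * cu A' (fun i => (axisReflect α q.1 - if (α = q.2.1.1 ∨ α = q.2.1.2) then e α else 0) i % N) q.2.1)
        = (reflSign α q.2.1.1 * reflSign α q.2.1.1) * (reflSign α q.2.1.2 * reflSign α q.2.1.2)
          * (cu A (fun i => (axisReflect α q.1 - if (α = q.2.1.1 ∨ α = q.2.1.2) then e α else 0) i % N) q.2.1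
            * cu A' (fun i => (axisReflect α q.1 - if (α = q.2.1.1 ∨ α = q.2.1.2) then e α else 0) i % N) q.2.1) := by
          ring
      _ = _ := by rw [hs, hs', one_mul, one_mul]
  rw [Finset.sum_congr rfl fun q _ => hlaw q]
  -- re-index Sp_{ρs} by the involutive pull-back onto Sp_s
  symm
  refine Finset.sum_nbij'
    (fun q => ((fun i => (axisReflect α q.1 - if (α = q.2.1.1 ∨ α = q.2.1.2) then e α else 0) i % N), q.2))
    (fun q => ((fun i => (axisReflect α q.1 - if (α = q.2.1.1 ∨ α = q.2.1.2) then e α else 0) i % N), q.2))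
    ?_ ?_ ?_ ?_ ?_
  · -- Sp_s → Sp_{ρs}: the pull-back for ρ s (ρ (ρ s) = s)
    intro q hq
    have hρρ : ρ α (ρ α s) = s := by
      rw [hρ, hρ]; funext i; simp only [Function.update_apply]; split_ifs with h <;> simp [h]
    have := pullback_mem_support hmN y hy P hP Sp hSp ρ hρ α (ρ α s) q (by rw [hρρ]; exact hq)
    exact this
  · intro q hq
    exact pullback_mem_support hmN y hy P hP Sp hSp ρ hρ α s q hq
  · intro q hq
    have hx := cube_subset_box hmN y hy P hP s (hSpP s q hq)
    exact Prod.ext (pullback_pullback hN α _ hx) rfl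
  · intro q hq
    have hx := cube_subset_box hmN y hy P hP (ρ α s) (hSpP _ q hq)
    exact Prod.ext (pullback_pullback hN α _ hx) rfl
  · intro q hq
    have hx := cube_subset_box hmN y hy P hP s (hSpP s q hq)
    dsimp only
    rw [pullback_pullback hN α _ hx]

end Hessian

/-! ## §4. Potentials, the remaining binders, and the non-zero total -/

section Block

variable {N m : ℤ}

/-- **The block's `hpot` for the orbit of cubes**: PART 29f's potentials with offset the cube's corner coordinate serve on Sp_s (the
o.1-coordinates of the sites of a cube of side m ≤ N − 2 avoid the seam residue). [folklore] -/
theorem potentials_on_cubes (hN : 0 < N) (hmN : m + 2 ≤ N) (y : (Fin d → Bool) → Fin d → ℤ)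
    (P : (Fin d → Bool) → Finset (Fin d → ℤ)) (hP : ∀ s, P s = Fintype.piFinset (fun i => Finset.Icc (y s i) (y s i + m)))
    (Sp : (Fin d → Bool) → Finset ((Fin d → ℤ) × {o : Fin d × Fin d // o.1 < o.2}))
    (hSp : ∀ s q, q ∈ Sp s ↔ (q.1 ∈ P s ∧ q.1 + e q.2.1.1 + e q.2.1.2 ∈ P s))
    (cu : ((Fin d → ℤ) → Fin d → ℝ) → (Fin d → ℤ) → Fin d × Fin d → ℝ)
    (hcu : ∀ A x o, cu A x o = A x o.1 + A (x + e o.1) o.2 - A (x + e o.2) o.1 - A x o.2)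
    (Apot : (Fin d → Bool) → {o : Fin d × Fin d // o.1 < o.2} → (Fin d → ℤ) → Fin d → ℝ)
    (hA : ∀ s o x c, Apot s o x c = if c = o.1.2 then (((x o.1.1 - y s o.1.1) % N : ℤ) : ℝ) else 0) (s : Fin d → Bool) :
    ∀ o, ∀ q ∈ Sp s, cu (Apot s o) q.1 q.2.1 = if q.2 = o then 1 else 0 := by
  refine hpot_of_cube hN cu hcu (Sp s) (fun o => y s o.1.1) (fun q hq => ?_) (Apot s) (hA s)
  obtain ⟨hx1, -⟩ := (hSp s q).1 hq
  rw [hP, mem_cube_iff] at hx1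
  have h1 := hx1 q.2.1.1
  have hmod : (q.1 q.2.1.1 - y s q.2.1.1) % N = q.1 q.2.1.1 - y s q.2.1.1 :=
    emod_eq_self_of_mem_range (by linarith) (by linarith)
  rw [hmod]
  linarith

/-- **The block's `hKS`, `hSpP`, `hρρ` and periodicity of the potentials for the orbit of cubes** (the factorization `hfac` holds by the
definition of Hs, and 𝒟 = all of {0,1}^d is stable under every ρ_α). [folklore] -/
theorem block_bookkeeping (y : (Fin d → Bool) → Fin d → ℤ) (P : (Fin d → Bool) → Finset (Fin d → ℤ))
    (Sp : (Fin d → Bool) → Finset ((Fin d → ℤ) × {o : Fin d × Fin d // o.1 < o.2}))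
    (hSp : ∀ s q, q ∈ Sp s ↔ (q.1 ∈ P s ∧ q.1 + e q.2.1.1 + e q.2.1.2 ∈ P s))
    (ρ : Fin d → (Fin d → Bool) → (Fin d → Bool)) (hρ : ∀ α s, ρ α s = Function.update s α (!(s α))) (b : ℝ)
    (K : (Fin d → Bool) → (Fin d → ℤ) × {o : Fin d × Fin d // o.1 < o.2} → (Fin d → ℤ) × {o : Fin d × Fin d // o.1 < o.2} → ℝ)
    (hK : ∀ s q q', K s q q' = if (q = q' ∧ q ∈ Sp s) then b else 0)
    (Apot : (Fin d → Bool) → {o : Fin d × Fin d // o.1 < o.2} → (Fin d → ℤ) → Fin d → ℝ)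
    (hA : ∀ s o x c, Apot s o x c = if c = o.1.2 then (((x o.1.1 - y s o.1.1) % N : ℤ) : ℝ) else 0) :
    (∀ s, ∀ q ∈ Sp s, q.1 ∈ P s) ∧
    (∀ s q q', (q ∉ Sp s ∨ q' ∉ Sp s) → K s q q' = 0) ∧
    (∀ α s, ρ α (ρ α s) = s) ∧
    (∀ s o, ∀ x v ν, Apot s o (x + N • v) ν = Apot s o x ν) := by
  refine ⟨fun s q hq => ((hSp s q).1 hq).1, fun s q q' h => ?_, fun α s => ?_, fun s o => ?_⟩
  · rw [hK, if_neg]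
    rintro ⟨rfl, hq⟩
    exact h.elim (fun h => h hq) (fun h => h hq)
  · rw [hρ, hρ]; funext i; simp only [Function.update_apply]; split_ifs with h <;> simp [h]
  · exact potential_periodic o.1.1 o.1.2 (y s o.1.1) (Apot s o) (hA s o)

/-- **THE TOTAL OF THE FAMILY AT A LABEL**: Σ_s Σ_{x,x′∈P_s} K_s((x,o₀),(x′,o₀)) = b·Σ_s #{x ∈ P_s : (x,o₀) ∈ Sp_s} — the number of
o₀-plaquettes inside the cubes, times b; non-zero as soon as b ≠ 0 and m ≥ 1 (each cube contains the o₀-plaquette at its corner). [folklore] -/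
theorem total_diag_eq (P : (Fin d → Bool) → Finset (Fin d → ℤ))
    (Sp : (Fin d → Bool) → Finset ((Fin d → ℤ) × {o : Fin d × Fin d // o.1 < o.2})) (b : ℝ)
    (K : (Fin d → Bool) → (Fin d → ℤ) × {o : Fin d × Fin d // o.1 < o.2} → (Fin d → ℤ) × {o : Fin d × Fin d // o.1 < o.2} → ℝ)
    (hK : ∀ s q q', K s q q' = if (q = q' ∧ q ∈ Sp s) then b else 0) (o₀ : {o : Fin d × Fin d // o.1 < o.2}) :
    ∑ s : Fin d → Bool, ∑ x ∈ P s, ∑ x' ∈ P s, K s (x, o₀) (x', o₀)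
      = b * ∑ s : Fin d → Bool, (((P s).filter (fun x => (x, o₀) ∈ Sp s)).card : ℝ) := by
  classical
  rw [Finset.mul_sum]
  refine Finset.sum_congr rfl fun s _ => ?_
  have h1 : ∀ x ∈ P s, ∑ x' ∈ P s, K s (x, o₀) (x', o₀) = if (x, o₀) ∈ Sp s then b else 0 := by
    intro x hx
    rw [Finset.sum_eq_single_of_mem x hx (fun x' _ hne => by
      rw [hK, if_neg (fun h => hne (congrArg Prod.fst h.1).symm)])]
    rw [hK]
    by_cases h : (x, o₀) ∈ Sp s
    · rw [if_pos ⟨rfl, h⟩, if_pos h]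
    · rw [if_neg (fun h' => h h'.2), if_neg h]
  rw [Finset.sum_congr rfl h1, ← Finset.sum_filter, Finset.sum_const, nsmul_eq_mul, mul_comm]

/-- … and each cube of side m ≥ 1 contains the o₀-plaquette at its corner, so the total is b times a positive integer. [folklore] -/
theorem corner_plaquette_mem (hm1 : 1 ≤ m) (y : (Fin d → Bool) → Fin d → ℤ) (P : (Fin d → Bool) → Finset (Fin d → ℤ))
    (hP : ∀ s, P s = Fintype.piFinset (fun i => Finset.Icc (y s i) (y s i + m)))
    (Sp : (Fin d → Bool) → Finset ((Fin d → ℤ) × {o : Fin d × Fin d // o.1 < o.2}))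
    (hSp : ∀ s q, q ∈ Sp s ↔ (q.1 ∈ P s ∧ q.1 + e q.2.1.1 + e q.2.1.2 ∈ P s)) (s : Fin d → Bool)
    (o₀ : {o : Fin d × Fin d // o.1 < o.2}) : y s ∈ (P s).filter (fun x => (x, o₀) ∈ Sp s) := by
  have hab : o₀.1.1 ≠ o₀.1.2 := ne_of_lt o₀.2
  rw [Finset.mem_filter, hSp, hP, mem_cube_iff, mem_cube_iff]
  refine ⟨fun i => ⟨le_rfl, by linarith⟩, fun i => ⟨le_rfl, by linarith⟩, fun i => ?_⟩
  simp only [Pi.add_apply, e_apply]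
  constructor
  · split_ifs <;> linarith
  · by_cases h1 : i = o₀.1.1
    · have h2 : ¬ i = o₀.1.2 := fun h => hab (h1.symm.trans h)
      rw [if_pos h1, if_neg h2]; linarith
    · by_cases h2 : i = o₀.1.2
      · rw [if_neg h1, if_pos h2]; linarith
      · rw [if_neg h1, if_neg h2]; linarith

/-- **THE TOTAL IS NON-ZERO** for b ≠ 0 and m ≥ 1: the reflection block of PARTs 29d ∕ 29e is inhabited by a family with a non-trivial
matrix of totals. [folklore] -/
theorem total_diag_ne_zero (hm1 : 1 ≤ m) (y : (Fin d → Bool) → Fin d → ℤ) (P : (Fin d → Bool) → Finset (Fin d → ℤ))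
    (hP : ∀ s, P s = Fintype.piFinset (fun i => Finset.Icc (y s i) (y s i + m)))
    (Sp : (Fin d → Bool) → Finset ((Fin d → ℤ) × {o : Fin d × Fin d // o.1 < o.2}))
    (hSp : ∀ s q, q ∈ Sp s ↔ (q.1 ∈ P s ∧ q.1 + e q.2.1.1 + e q.2.1.2 ∈ P s)) {b : ℝ} (hb : b ≠ 0)
    (K : (Fin d → Bool) → (Fin d → ℤ) × {o : Fin d × Fin d // o.1 < o.2} → (Fin d → ℤ) × {o : Fin d × Fin d // o.1 < o.2} → ℝ)
    (hK : ∀ s q q', K s q q' = if (q = q' ∧ q ∈ Sp s) then b else 0) (o₀ : {o : Fin d × Fin d // o.1 < o.2}) :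
    ∑ s : Fin d → Bool, ∑ x ∈ P s, ∑ x' ∈ P s, K s (x, o₀) (x', o₀) ≠ 0 := by
  classical
  rw [total_diag_eq P Sp b K hK o₀]
  refine mul_ne_zero hb (ne_of_gt ?_)
  have hpos : ∀ s : Fin d → Bool, (0 : ℝ) < (((P s).filter (fun x => (x, o₀) ∈ Sp s)).card : ℝ) := fun s => by
    exact_mod_cast Finset.card_pos.2 ⟨y s, corner_plaquette_mem hm1 y P hP Sp hSp s o₀⟩
  exact Finset.sum_pos (fun s _ => hpos s) ⟨fun _ => false, Finset.mem_univ _⟩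

end Block

end Summit.QuantumFields.BalabanUV.Beta.EriceCurvatureFormHessianCovarianceWitness
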